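import Summits.ValiantsHypothesis.ValiantsHypothesis.Theorems.BarrierLeverChowBenchmarkPairsPeelRows

/-!
# Route BarrierLever — item 22038 `ChowBenchmarkPairs`, line `moore-peel`: the RIGID EXTENSION (PEELING) LEMMA
# for the segment-moment rows — adjoining one point `x·𝟙_A` on a set `A` met by no old column extends a
# nonsingular column family by `n+1` columns above `A`

Helper file (`--supports stmt-ValiantsHypothesis-22038`; cell valiant-natproofs, rung V4, 𝒟-side benchmark of record;
seat val-np-p4 gen 21).  Closes NO item.  Companion of the typed node CONJECTURE GTN
(`…ChowBenchmarkPairsGTN.lean`, `Stmt.gtn`: for every column family through `∅` some table is nonsingular) — this file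
is the kernel form of the one algebraic tool the seat found for producing GTN instances by induction on the number of
points (memo HOME/val-np-p4/g21/MEMO-gtn-peeling-tropical-valnp4-g21.md §0.4).

SETTING.  `segE P S T = Σ_{g : T → S} ∏_{c∈T} P_{g(c),c} · ∏_{a∈S} |g⁻¹(a)|!` is the segment-moment entry of a point
table `P` (points `π`, coordinates `κ`, any commutative ring; the line file's `segEntry` verbatim).  The rows of an
`n`-point configuration are the subsets of size `≤ 2` (`Row n`); a point `q` is adjoined as `none : Option (Fin n)`
(`adjoin`), and the rows of the enlarged configuration are `rowSet` = old rows, `{new}`, `{a, new}` — exactly the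
subsets of size `≤ 2` of the `n+1` points (`card_rowSet_le_two`, `rowSet_injective`, `exists_rowSet_eq`).

THEOREM (`rigid_extension`, `rigid_extension_finite`, `det_symbMatrix_ne_zero`).  Let the old matrix
`[segE P S (T S')]_{S,S' ∈ Row n}` be nonsingular, let `A ⊆ κ` be contained in NO old column `T S'`, and let
`U : Option (Fin n) → Finset κ` be `n+1` new columns all containing `A` whose VANDERMONDE BLOCK
`vand P i (U j ∖ A)` — row `{new}` = the point `0` (`[D = ∅]`), row `{a,new}` = the point `P_a` (`|D|!·P_a^D`) — is
nonsingular.  Then the symbolic determinant (new point `X·𝟙_A`, over `ℂ[X]`) is a nonzero polynomial, so for all but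
finitely many `x` the table `P ⊔ {x·𝟙_A}` is nonsingular on the columns `T ⊔ U`.
MECHANISM (the «peeling lemma»): a new row has `X`-degree `≤ |A|` with top coefficient `[T = A]·|A|!` (`{new}`,
`coeff_new_single`) resp. `[A ⊆ T]·|A|!·|T∖A|!·P_a^{T∖A}` (`{a,new}`, `coeff_new_pair`); multiplying the old rows by
`X^{|A|}`, the coefficient of `X^{N|A|}` of the determinant is the determinant of the top-coefficient matrix
(`coeff_det_of_natDegree_le`), which is block-triangular — the new rows' top coefficients vanish on the old columns
because `A ⊄ T S'` — with diagonal blocks the old matrix and `|A|!·`Vandermonde (`Matrix.det_fromBlocks_zero₂₁`).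

REACH (numerics of the seat).  Iterating the lemma from `n = 0` («rigid up-set peeling»: at each step the new columns
are ALL members of the target family containing `A`, exactly `n+1` of them) reaches the benchmark window `W_h` (first
`r_h` binary codes) for `h ∈ {1,2,3,4,8}` and for no other `h ≤ 14` (exhaustive search; already the first step is
impossible for h = 19, 21–26, 28–30, …): up-sets of an initial code segment have sizes `2^{t−|A|} + #{T' ∈ W' ⊇ A}`.
So this is an ENGINE for GTN instances, not a route to `stub_segmentMeanValue` by itself; the honest residual is the
same step with MORE than `n+1` columns above `A` (a signed Laplace sum).  Iteration in the kernel needs the Vandermonde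
hypothesis at the table produced by the previous step; `rigid_extension_finite` (cofinite good `x`) is the form to use.

WHAT THIS IS NOT: no stub of the line is closed; nothing on crux stmt-ValiantsHypothesis-14610 or on `VP` versus `VNP`.
-/

set_option linter.dupNamespace false

namespace Summit.ValiantsHypothesis.ValiantsHypothesis.Theorems.BarrierLever.ChowBenchmarkPeel

open Finset Polynomial

variable {κ : Type*} [DecidableEq κ]

/-! ## 6. The rigid extension theorem -/

section Main

variable {n : ℕ}

/-- The rows of the enlarged configuration, indexed by `Row n ⊕ Option (Fin n)`: the old rows `S.map some`, the new
singleton row `{new}` and the new pair rows `{a, new}` — together exactly the subsets of size `≤ 2` of `Option (Fin n)`. -/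
def rowSet : Row n ⊕ Option (Fin n) → Finset (Option (Fin n))
  | Sum.inl S => S.1.map Function.Embedding.some
  | Sum.inr none => {none}
  | Sum.inr (some a) => {some a, none}

/-- The Vandermonde-type block of the peeling step: row `{new}` is the point `0` (`[D = ∅]`), row `{a, new}` is the
point `P_a` (`|D|!·P_a^D`), at the monomial `z^D`. -/
def vand (P : Fin n → κ → ℂ) : Option (Fin n) → Finset κ → ℂ
  | none, D => if D = ∅ then 1 else 0
  | some a, D => (D.card.factorial : ℂ) * ∏ c ∈ D, P a c

/-- The symbolic segment-moment matrix of the enlarged configuration (new point `X·𝟙_A`) on the columns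
`T ⊔ U`, over `ℂ[X]`. -/
noncomputable def symbMatrix (P : Fin n → κ → ℂ) (T : Row n → Finset κ) (U : Option (Fin n) → Finset κ)
    (A : Finset κ) : Matrix (Row n ⊕ Option (Fin n)) (Row n ⊕ Option (Fin n)) ℂ[X] :=
  Matrix.of fun i j => segE (symbTable P A) (rowSet i) (Sum.elim T U j)

/-- Evaluating the symbolic matrix at `x` gives the segment-moment matrix of the table `P ⊔ {x·𝟙_A}`. -/
theorem eval_det_symbMatrix (P : Fin n → κ → ℂ) (T : Row n → Finset κ) (U : Option (Fin n) → Finset κ)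
    (A : Finset κ) (x : ℂ) :
    (symbMatrix P T U A).det.eval x = (Matrix.of fun i j : Row n ⊕ Option (Fin n) =>
      segE (adjoin P (indPt A x)) (rowSet i) (Sum.elim T U j)).det := by
  classical
  have h1 : (Polynomial.evalRingHom x) (symbMatrix P T U A).det =
      ((Polynomial.evalRingHom x).mapMatrix (symbMatrix P T U A)).det :=
    RingHom.map_det _ _
  rw [Polynomial.coe_evalRingHom] at h1
  rw [h1]
  congr 1
  ext i j
  rw [RingHom.mapMatrix_apply, Matrix.map_apply, symbMatrix, Matrix.of_apply, Matrix.of_apply,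
    Polynomial.coe_evalRingHom, ← Polynomial.coe_evalRingHom, map_segE]
  congr 1
  funext o c
  cases o with
  | none =>
    simp only [symbTable, adjoin_none, indPt, Polynomial.coe_evalRingHom]
    split_ifs <;> simp
  | some a => simp [symbTable, constTable]

/-- **The determinant of the symbolic matrix is a nonzero polynomial** under the hypotheses of the peeling step:
`A` lies in no old column, every new column contains `A`, the old matrix is nonsingular at `P` and so is the
Vandermonde block.  (Over `ℂ[X]`: every new row has degree `≤ |A|` with top coefficient
`[A ⊆ T]·|A|!·|T∖A|!·P_a^{T∖A}` resp. `[T = A]·|A|!`; after multiplying the old rows by `X^{|A|}` the coefficient of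
`X^{N|A|}` of the determinant is the determinant of the top-coefficient matrix, which is block triangular with diagonal
blocks the old matrix and `|A|!`·(the Vandermonde block).) -/
theorem det_symbMatrix_ne_zero (P : Fin n → κ → ℂ) (T : Row n → Finset κ) (U : Option (Fin n) → Finset κ)
    (A : Finset κ) (hA : ∀ S, ¬ A ⊆ T S) (hU : ∀ j, A ⊆ U j)
    (hold : (Matrix.of fun S S' : Row n => segE P S.1 (T S')).det ≠ 0)
    (hV : (Matrix.of fun i j : Option (Fin n) => vand P i (U j \ A)).det ≠ 0) :
    (symbMatrix P T U A).det ≠ 0 := by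
  classical
  set MX := symbMatrix P T U A with hMX0
  have hMX : MX = Matrix.of fun i j => segE (symbTable P A) (rowSet i) (Sum.elim T U j) := rfl
  -- scale the old rows by `X^|A|`
  set w : Row n ⊕ Option (Fin n) → ℂ[X] := Sum.elim (fun _ => X ^ A.card) (fun _ => 1) with hw
  set MX' : Matrix (Row n ⊕ Option (Fin n)) (Row n ⊕ Option (Fin n)) ℂ[X] :=
    Matrix.of fun i j => w i * MX i j with hMX'
  have hdet' : MX'.det = (∏ i, w i) * MX.det := Matrix.det_mul_column w MX
  suffices hne' : MX'.det ≠ 0 by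
    intro h0; apply hne'; rw [hdet', h0, mul_zero]
  -- degrees of the entries
  have hdeg : ∀ i j, (MX' i j).natDegree ≤ A.card := by
    intro i j
    rw [hMX', Matrix.of_apply, hMX, Matrix.of_apply]
    cases i with
    | inl S =>
      rw [hw, Sum.elim_inl, rowSet, segE_symbTable_old, mul_comm]
      exact natDegree_C_mul_X_pow_le _ _
    | inr o =>
      rw [hw, Sum.elim_inr, one_mul]
      cases o with
      | none => exact natDegree_new_single_le P A _
      | some a => exact natDegree_new_pair_le P A a _
  -- the top-coefficient matrix is block triangular
  have htop : (Matrix.of fun i j => (MX' i j).coeff A.card) =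
      Matrix.fromBlocks (Matrix.of fun S S' : Row n => segE P S.1 (T S'))
        (Matrix.of fun (S : Row n) (j : Option (Fin n)) => segE P S.1 (U j))
        0 (Matrix.of fun i j : Option (Fin n) => (A.card.factorial : ℂ) * vand P i (U j \ A)) := by
    ext i j
    rcases i with S | o <;> rcases j with S' | j'
    · rw [Matrix.of_apply, Matrix.fromBlocks_apply₁₁, Matrix.of_apply, hMX', Matrix.of_apply, hMX, Matrix.of_apply,
        hw, Sum.elim_inl, Sum.elim_inl, rowSet, segE_symbTable_old, mul_comm, coeff_C_mul_X_pow, if_pos rfl]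
    · rw [Matrix.of_apply, Matrix.fromBlocks_apply₁₂, Matrix.of_apply, hMX', Matrix.of_apply, hMX, Matrix.of_apply,
        hw, Sum.elim_inl, Sum.elim_inr, rowSet, segE_symbTable_old, mul_comm, coeff_C_mul_X_pow, if_pos rfl]
    · rw [Matrix.of_apply, Matrix.fromBlocks_apply₂₁, Matrix.zero_apply, hMX', Matrix.of_apply, hMX, Matrix.of_apply,
        hw, Sum.elim_inr, Sum.elim_inl, one_mul]
      cases o with
      | none =>
        rw [rowSet, coeff_new_single, if_neg]
        intro e; exact hA S' (e ▸ Finset.Subset.refl _)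
      | some a =>
        rw [rowSet, coeff_new_pair, if_neg (hA S')]
    · rw [Matrix.of_apply, Matrix.fromBlocks_apply₂₂, Matrix.of_apply, hMX', Matrix.of_apply, hMX, Matrix.of_apply,
        hw, Sum.elim_inr, Sum.elim_inr, one_mul]
      cases o with
      | none =>
        rw [rowSet, coeff_new_single, vand]
        by_cases h : U j' = A
        · rw [if_pos h, if_pos (by rw [h, Finset.sdiff_self]), mul_one]
        · rw [if_neg h, if_neg, mul_zero]
          intro e
          exact h (Finset.Subset.antisymm (Finset.sdiff_eq_empty_iff_subset.mp e) (hU j'))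
      | some a =>
        rw [rowSet, coeff_new_pair, if_pos (hU j'), vand]
        ring
  -- the coefficient of `X^{N |A|}` of `det MX'`
  have hcoeff : MX'.det.coeff (Fintype.card (Row n ⊕ Option (Fin n)) * A.card) ≠ 0 := by
    rw [coeff_det_of_natDegree_le MX' A.card hdeg, htop, Matrix.det_fromBlocks_zero₂₁]
    refine mul_ne_zero hold ?_
    rw [show (Matrix.of fun i j : Option (Fin n) => (A.card.factorial : ℂ) * vand P i (U j \ A)) =
      Matrix.of (fun i j => (fun _ : Option (Fin n) => (A.card.factorial : ℂ)) i *
        (Matrix.of fun i j : Option (Fin n) => vand P i (U j \ A)) i j) from rfl, Matrix.det_mul_column]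
    refine mul_ne_zero ?_ hV
    rw [Finset.prod_const]
    exact pow_ne_zero _ (Nat.cast_ne_zero.mpr (Nat.factorial_ne_zero _))
  intro h0
  rw [h0, coeff_zero] at hcoeff
  exact hcoeff rfl

/-- **RIGID EXTENSION (PEELING) LEMMA, cofinite form.**  Under the hypotheses of `det_symbMatrix_ne_zero`, for all
but finitely many scalars `x` the enlarged table `P ⊔ {x·𝟙_A}` has a nonsingular segment-moment matrix on the
columns `T ⊔ U` (rows: all subsets of size `≤ 2` of the `n+1` points, `rowSet`). -/
theorem rigid_extension_finite (P : Fin n → κ → ℂ) (T : Row n → Finset κ) (U : Option (Fin n) → Finset κ)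
    (A : Finset κ) (hA : ∀ S, ¬ A ⊆ T S) (hU : ∀ j, A ⊆ U j)
    (hold : (Matrix.of fun S S' : Row n => segE P S.1 (T S')).det ≠ 0)
    (hV : (Matrix.of fun i j : Option (Fin n) => vand P i (U j \ A)).det ≠ 0) :
    Set.Finite {x : ℂ | (Matrix.of fun i j : Row n ⊕ Option (Fin n) =>
      segE (adjoin P (indPt A x)) (rowSet i) (Sum.elim T U j)).det = 0} := by
  have hne := det_symbMatrix_ne_zero P T U A hA hU hold hV
  refine (Polynomial.finite_setOf_isRoot hne).subset fun x hx => ?_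
  rw [Set.mem_setOf_eq, Polynomial.IsRoot.def, eval_det_symbMatrix]
  exact hx

/-- **RIGID EXTENSION (PEELING) LEMMA.**  Let `P` be an `n`-point table whose segment-moment matrix on a column
family `T` (indexed by the rows) is nonsingular, let `A` be a set of coordinates contained in NO column of `T`, and
let `U` be `n+1` further columns all containing `A` such that the Vandermonde block
`[vand P i (U j ∖ A)]` (points `0, P_0, …, P_{n-1}`, monomials `z^{U_j ∖ A}`) is nonsingular.  Then for some scalar
`x` the enlarged table `P ⊔ {x·𝟙_A}` has a nonsingular segment-moment matrix on the columns `T ⊔ U`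
(rows: all subsets of size `≤ 2` of the `n+1` points). -/
theorem rigid_extension (P : Fin n → κ → ℂ) (T : Row n → Finset κ) (U : Option (Fin n) → Finset κ)
    (A : Finset κ) (hA : ∀ S, ¬ A ⊆ T S) (hU : ∀ j, A ⊆ U j)
    (hold : (Matrix.of fun S S' : Row n => segE P S.1 (T S')).det ≠ 0)
    (hV : (Matrix.of fun i j : Option (Fin n) => vand P i (U j \ A)).det ≠ 0) :
    ∃ x : ℂ, (Matrix.of fun i j : Row n ⊕ Option (Fin n) =>
      segE (adjoin P (indPt A x)) (rowSet i) (Sum.elim T U j)).det ≠ 0 := by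
  have hfin := rigid_extension_finite P T U A hA hU hold hV
  obtain ⟨x, hx⟩ := Set.Infinite.nonempty (Set.Finite.infinite_compl hfin)
  exact ⟨x, hx⟩

/-! ### The rows of the enlarged configuration are exactly the subsets of size `≤ 2` -/

/-- Rows have size `≤ 2`. -/
theorem card_rowSet_le_two (i : Row n ⊕ Option (Fin n)) : (rowSet i).card ≤ 2 := by
  rcases i with S | (_ | a)
  · rw [rowSet, Finset.card_map]; exact S.2
  · rw [rowSet, Finset.card_singleton]; omega
  · rw [rowSet]; exact Finset.card_le_two

/-- Distinct indices give distinct rows. -/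
theorem rowSet_injective : Function.Injective (rowSet (n := n)) := by
  classical
  have hnone : ∀ S : Row n, none ∉ (rowSet (Sum.inl S) : Finset (Option (Fin n))) := by
    intro S h
    rw [rowSet, Finset.mem_map] at h
    obtain ⟨a, _, ha⟩ := h
    exact Option.some_ne_none a ha
  have hnone' : ∀ o : Option (Fin n), none ∈ (rowSet (Sum.inr o) : Finset (Option (Fin n))) := by
    rintro (_ | a) <;> simp [rowSet]
  intro i j h
  rcases i with S | o <;> rcases j with S' | o'
  · congr 1
    apply Subtype.ext
    rw [rowSet, rowSet] at h
    exact Finset.map_injective _ h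
  · exact absurd (h ▸ hnone' o') (hnone S)
  · exact absurd (h.symm ▸ hnone' o) (hnone S')
  · congr 1
    rcases o with _ | a <;> rcases o' with _ | a'
    · rfl
    · exfalso
      have : (some a' : Option (Fin n)) ∈ rowSet (Sum.inr none) := by rw [h, rowSet]; simp
      simp [rowSet] at this
    · exfalso
      have : (some a : Option (Fin n)) ∈ rowSet (Sum.inr none) := by rw [← h, rowSet]; simp
      simp [rowSet] at this
    · have : (some a : Option (Fin n)) ∈ rowSet (Sum.inr (some a')) := by rw [← h, rowSet]; simp
      simp [rowSet] at this
      rw [this]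

/-- Every subset of size `≤ 2` of the enlarged point set is a row. -/
theorem exists_rowSet_eq (S' : Finset (Option (Fin n))) (hS' : S'.card ≤ 2) : ∃ i, rowSet i = S' := by
  classical
  by_cases hn : none ∈ S'
  · -- S' = {none} ∪ (at most one `some a`)
    have hcard : (S'.erase none).card ≤ 1 := by
      rw [Finset.card_erase_of_mem hn]; omega
    rcases Nat.lt_or_ge (S'.erase none).card 1 with h0 | h1
    · refine ⟨Sum.inr none, ?_⟩
      rw [rowSet]
      have : S'.erase none = ∅ := Finset.card_eq_zero.mp (by omega)
      rw [← Finset.insert_erase hn, this]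
      rfl
    · obtain ⟨o, ho⟩ := Finset.card_eq_one.mp (le_antisymm hcard h1)
      have hoS : o ∈ S'.erase none := by rw [ho]; exact Finset.mem_singleton_self o
      obtain ⟨a, rfl⟩ : ∃ a, o = some a := by
        rcases o with _ | a
        · exact absurd hoS (Finset.notMem_erase none S')
        · exact ⟨a, rfl⟩
      refine ⟨Sum.inr (some a), ?_⟩
      rw [rowSet, ← Finset.insert_erase hn, ho, Finset.insert_eq, Finset.union_comm, ← Finset.insert_eq]
  · -- S' consists of old points only
    have hpre : ∀ o ∈ S', ∃ a, o = some a := by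
      intro o ho
      rcases o with _ | a
      · exact absurd ho hn
      · exact ⟨a, rfl⟩
    have hfilter : S'.filter (fun x => x ∈ Set.range (some : Fin n → Option (Fin n))) = S' :=
      Finset.filter_true_of_mem fun o ho => by obtain ⟨a, rfl⟩ := hpre o ho; exact ⟨a, rfl⟩
    have hinj : Set.InjOn (some : Fin n → Option (Fin n)) (some ⁻¹' (S' : Set (Option (Fin n)))) :=
      (Option.some_injective _).injOn
    have hmap : (S'.preimage some hinj).map Function.Embedding.some = S' := by
      rw [Finset.map_eq_image]
      have : (⇑(Function.Embedding.some : Fin n ↪ Option (Fin n))) = some := rfl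
      rw [this, Finset.image_preimage, hfilter]
    have hcard : (S'.preimage some hinj).card ≤ 2 := by
      rw [← Finset.card_map Function.Embedding.some, hmap]; exact hS'
    exact ⟨Sum.inl ⟨_, hcard⟩, hmap⟩

end Main

end Summit.ValiantsHypothesis.ValiantsHypothesis.Theorems.BarrierLever.ChowBenchmarkPeel
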